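import Literature.AlgebraicGeometry.KTheory.EulerCharShortExact
import Literature.AlgebraicGeometry.Modules.StrictlyPerfectResolutionExistsHolds
import HarnessLib

/-!
# Discharge of the named fact `Hartshorne1977_eulerChar_resolution_shortExact` (Hartshorne III Ex. 6.9 (b))

Layer `Literature/AlgebraicGeometry/KTheory`. The named fact
`KTheory/CoherentEulerCharacteristic.Hartshorne1977_eulerChar_resolution_shortExact` — on a noetherian, integral,
separated, regular scheme, for every short exact sequence `0 → F₁ → F₂ → F₃ → 0` of coherent `𝒪_X`-modules and any
strictly perfect resolutions `Rᵢ` of the `Fᵢ`, `[F₂] = [F₁] + [F₃]` in `K₀(X)` (resolution independence of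
`Σ(−1)ⁱ[ℰ_i]` is the case `F₁ = 0`; Hartshorne III Ex. 6.9 (b), Fulton App. B.8.3 (iii)–(v)) — is PROVED,
literally as typed, by composing

* `KTheory/EulerCharShortExact.KZero.ofCoh_shortExact_of_hres` (additivity on any resolutions on a locally
  noetherian scheme on which every coherent module HAS a strictly perfect resolution — adapted resolutions and the
  `D(Mod 𝒪_X)`-invariance of `χ`), with
* the resolution-existence fact now a theorem,
  `Modules/StrictlyPerfectResolutionExistsHolds.Hartshorne1977_exists_strictlyPerfectResolution_holds`
  (Kleiman's theorem + Auslander–Buchsbaum–Serre termination on noetherian regular schemes).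

One theorem, no definitions, no instances; no consumer of the fact is edited (`HodgeTheory/ChernCharacterCoherent`,
`KTheory/CoherentEulerCharacteristic` §3 etc. are fed by name).

## References

* R. Hartshorne, *Algebraic Geometry*, GTM 52 (1977), III Ex. 6.9 (b) (p. 239). [Hartshorne1977]
* W. Fulton, *Intersection Theory*, 2nd ed. (1998), App. B.8.3 (iii)–(v). [Fulton1998]
* A. Borel, J.-P. Serre, *Le théorème de Riemann–Roch*, Bull. SMF 86 (1958), §4 Lemmes 11–12. [BorelSerre1958]
-/

noncomputable section

universe u

open CategoryTheory AlgebraicGeometry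

namespace Literature.AlgebraicGeometry.KTheory

open Literature.AlgebraicGeometry.Modules Literature.AlgebraicGeometry.Morphisms

/-- **Hartshorne III Ex. 6.9 (b) holds**: on a noetherian, integral, separated, regular scheme,
`[F₂] = [F₁] + [F₃] ∈ K₀(X)` for every short exact sequence of coherent sheaves, computed on any strictly perfect
resolutions (in particular `Σ(−1)ⁱ[ℰ_i]` is independent of the resolution) — the named fact
`Hartshorne1977_eulerChar_resolution_shortExact`, discharged by `KZero.ofCoh_shortExact_of_hres` with
`hres := Hartshorne1977_exists_strictlyPerfectResolution_holds`.
[cite: Hartshorne1977, III Ex. 6.9 (b) (p. 239)] [cite: Fulton1998, App. B.8.3 (iii)–(v)] -/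
theorem Hartshorne1977_eulerChar_resolution_shortExact_holds :
    Hartshorne1977_eulerChar_resolution_shortExact.{u} := by
  intro X _ _ _ hreg S hS _ h₂ _ R₁ R₂ R₃
  exact KZero.ofCoh_shortExact_of_hres
    (fun G hG => Hartshorne1977_exists_strictlyPerfectResolution_holds X hreg G hG) hS h₂ R₁ R₂ R₃

end Literature.AlgebraicGeometry.KTheory

end
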